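import Literature.AlgebraicGeometry.Motives.AbelianVarietyQuotientAct
import HarnessLib

/-!
# The quotient abelian variety `P/S` and the isogeny `h : P → P/S`

Continuation of `AbelianVarietyQuotientAct`. With the descended action `act : P × P/S → P/S`:

* `mul_comp_quotientMapOver_eq_of_eq`: `h(a₁b₁) = h(a₂b₂)` if `h a₁ = h a₂`, `h b₁ = h b₂`
  (`T`-points; via `act` and the commutativity of `P`);
* `quotMul` (descent of `μ ≫ h` along `h ⊗ h`), `quotOne = η ≫ h`, `quotInv` (descent of
  `ι ≫ h` along `h`), and `grpObj_quotOver`: the group-scheme structure on `P/S`, the axioms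
  being checked after the epimorphisms `h`, `h ⊗ h`, `(h ⊗ h) ⊗ h`; `isMonHom_quotientMapOver`;
* `quot : AbelianVariety K` (**the quotient abelian variety**), `quotHom : P ⟶ P.quot …`,
  `isIsogeny_quotHom`;
* `comp_eq_one_of_comp_quotientMapOver_eq_one`: `Ker h ⊆ Ker q` on `T`-points;
  `comp_quotientMapOver_eq_one_iff`: on `Ω`-points with an `L`-structure, `h x = 1 ↔ x ∈ S · λ`.

Mumford, *Abelian Varieties*, §7 Thm. 4 (p. 72: `X → X/S` is an isogeny of abelian varieties
with kernel `S`), §12 Thm. 1; Kieffer 2024, Prop. 1.1.10.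

## References

* [MumfordAV1970] D. Mumford, *Abelian Varieties*, §7 Thm. 4 (p. 72), §12 Thm. 1.
* [Kieffer2024IsogenyGraphs] J. Kieffer, Prop. 1.1.10 (p. 10).
-/

noncomputable section

universe u

open CategoryTheory CategoryTheory.Limits AlgebraicGeometry

namespace Literature.AlgebraicGeometry.Motives

namespace AbelianVariety

open scoped MonObj Obj
open Literature.AlgebraicGeometry.RelativeSpec Literature.AlgebraicGeometry.Morphisms
open MonoidalCategory CartesianMonoidalCategory

variable {K : Type u} [Field K] (L : Type u) [Field L] [Algebra K L] (P : AbelianVariety K)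
variable (S : Subgroup (P.Points L))
  (hS : ∀ (σ : L ≃ₐ[K] L) (s : P.Points L), s ∈ S → σ • s ∈ S)
  (q : P ⟶ P) (hSq : ∀ s ∈ S, s ≫ q.hom.hom.hom = 1)
variable [FiniteDimensional K L] [IsGalois K L] [Finite S] [IsAffineHom (Hom.toSchemeHom q)]

/-! ### `h(a · b)` only depends on `a` and `h(b)` -/

/-- `h (a · b) = act (a, h b)` on `T`-points. [folklore] -/
theorem mul_comp_quotientMapOver {T : SchemeOver K} (a b : T ⟶ P.X) :
    (a * b) ≫ P.quotientMapOver L S hS q hSq =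
      lift a (b ≫ P.quotientMapOver L S hS q hSq) ≫ P.quotAct L S hS q hSq := by
  rw [Hom.mul_def, Category.assoc, ← whiskerLeft_quotAct, lift_whiskerLeft_assoc]

/-- **`h(a₁ · b₁) = h(a₂ · b₂)` whenever `h a₁ = h a₂` and `h b₁ = h b₂`** (`T`-points):
`h(a₁ b₁) = act(a₁, h b₁) = act(a₁, h b₂) = h(a₁ b₂) = h(b₂ a₁) = act(b₂, h a₁) = act(b₂, h a₂)
= h(b₂ a₂) = h(a₂ b₂)`, using the commutativity of `P`. [folklore] -/
theorem mul_comp_quotientMapOver_eq_of_eq {T : SchemeOver K} (a₁ a₂ b₁ b₂ : T ⟶ P.X)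
    (ha : a₁ ≫ P.quotientMapOver L S hS q hSq = a₂ ≫ P.quotientMapOver L S hS q hSq)
    (hb : b₁ ≫ P.quotientMapOver L S hS q hSq = b₂ ≫ P.quotientMapOver L S hS q hSq) :
    (a₁ * b₁) ≫ P.quotientMapOver L S hS q hSq = (a₂ * b₂) ≫ P.quotientMapOver L S hS q hSq := by
  rw [mul_comp_quotientMapOver, hb, ← mul_comp_quotientMapOver, mul_comm a₁, mul_comm a₂,
    mul_comp_quotientMapOver, ha, ← mul_comp_quotientMapOver]

/-! ### The multiplication of `P/S` -/

/-- `h ⊗ h` is flat. [folklore] -/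
instance flat_tensorHom_quotientMapOver_left :
    Flat (P.quotientMapOver L S hS q hSq ⊗ₘ P.quotientMapOver L S hS q hSq).left :=
  tensorHom_left_mem @Flat _ _ inferInstance inferInstance

/-- `h ⊗ h` is surjective. [folklore] -/
instance surjective_tensorHom_quotientMapOver_left :
    Surjective (P.quotientMapOver L S hS q hSq ⊗ₘ P.quotientMapOver L S hS q hSq).left :=
  tensorHom_left_mem @Surjective _ _ inferInstance inferInstance

/-- `h ⊗ h` is quasi-compact. [folklore] -/
instance quasiCompact_tensorHom_quotientMapOver_left :
    QuasiCompact (P.quotientMapOver L S hS q hSq ⊗ₘ P.quotientMapOver L S hS q hSq).left :=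
  tensorHom_left_mem @QuasiCompact _ _ inferInstance inferInstance

/-- `h ⊗ h` is an epimorphism of `K`-schemes. [folklore] -/
instance epi_tensorHom_quotientMapOver :
    Epi (P.quotientMapOver L S hS q hSq ⊗ₘ P.quotientMapOver L S hS q hSq) :=
  epi_of_flat_left _

/-- The descent datum for the multiplication: `μ ≫ h` coequalises the kernel pair of `h ⊗ h`.
[folklore] -/
theorem mulDesc_cond {Z : Scheme.{u}} (g₁ g₂ : Z ⟶ (P.X ⊗ P.X).left)
    (hg : g₁ ≫ (P.quotientMapOver L S hS q hSq ⊗ₘ P.quotientMapOver L S hS q hSq).left =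
      g₂ ≫ (P.quotientMapOver L S hS q hSq ⊗ₘ P.quotientMapOver L S hS q hSq).left) :
    g₁ ≫ (μ ≫ P.quotientMapOver L S hS q hSq).left =
      g₂ ≫ (μ ≫ P.quotientMapOver L S hS q hSq).left := by
  let ZO : SchemeOver K := Over.mk (g₁ ≫ (P.X ⊗ P.X).hom)
  let G₁ : ZO ⟶ P.X ⊗ P.X := Over.homMk g₁ rfl
  have hw₂ : g₂ ≫ (P.X ⊗ P.X).hom = g₁ ≫ (P.X ⊗ P.X).hom := by
    rw [← Over.w (P.quotientMapOver L S hS q hSq ⊗ₘ P.quotientMapOver L S hS q hSq),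
      ← Category.assoc, ← hg, Category.assoc]
  let G₂ : ZO ⟶ P.X ⊗ P.X := Over.homMk g₂ hw₂
  have hG : G₁ ≫ (P.quotientMapOver L S hS q hSq ⊗ₘ P.quotientMapOver L S hS q hSq) =
      G₂ ≫ (P.quotientMapOver L S hS q hSq ⊗ₘ P.quotientMapOver L S hS q hSq) :=
    Over.OverMorphism.ext hg
  have ha : (G₁ ≫ fst _ _) ≫ P.quotientMapOver L S hS q hSq =
      (G₂ ≫ fst _ _) ≫ P.quotientMapOver L S hS q hSq := by
    simpa only [Category.assoc, tensorHom_fst] using congrArg (· ≫ fst _ _) hG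
  have hb : (G₁ ≫ snd _ _) ≫ P.quotientMapOver L S hS q hSq =
      (G₂ ≫ snd _ _) ≫ P.quotientMapOver L S hS q hSq := by
    simpa only [Category.assoc, tensorHom_snd] using congrArg (· ≫ snd _ _) hG
  have e : ∀ G : ZO ⟶ P.X ⊗ P.X, G ≫ μ = (G ≫ fst _ _) * (G ≫ snd _ _) := fun G ↦ by
    rw [Hom.mul_def, lift_comp_fst_snd]
  change (G₁ ≫ μ ≫ P.quotientMapOver L S hS q hSq).left =
    (G₂ ≫ μ ≫ P.quotientMapOver L S hS q hSq).left
  rw [← Category.assoc, ← Category.assoc, e, e,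
    P.mul_comp_quotientMapOver_eq_of_eq L S hS q hSq _ _ _ _ ha hb]

/-- **The multiplication `P/S ×_K P/S → P/S`**: the descent of `μ ≫ h` along the effective
epimorphism `h ⊗ h` (Mumford, *Abelian Varieties*, §7 Thm. 4; §12). [cite: MumfordAV1970, §7 Thm. 4 p. 72] -/
def quotMul : P.quotOver L S hS q hSq ⊗ P.quotOver L S hS q hSq ⟶ P.quotOver L S hS q hSq :=
  Over.homMk (EffectiveEpi.desc
    (P.quotientMapOver L S hS q hSq ⊗ₘ P.quotientMapOver L S hS q hSq).left
    (μ ≫ P.quotientMapOver L S hS q hSq).left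
    (fun g₁ g₂ hg ↦ P.mulDesc_cond L S hS q hSq g₁ g₂ hg)) (by
      rw [← cancel_epi (P.quotientMapOver L S hS q hSq ⊗ₘ P.quotientMapOver L S hS q hSq).left,
        EffectiveEpi.fac_assoc, Over.w, Over.w])

/-- The defining property of the multiplication: `(h ⊗ h) ≫ μ_{P/S} = μ ≫ h`. [folklore] -/
@[reassoc]
theorem tensorHom_quotMul :
    (P.quotientMapOver L S hS q hSq ⊗ₘ P.quotientMapOver L S hS q hSq) ≫ P.quotMul L S hS q hSq =
      μ ≫ P.quotientMapOver L S hS q hSq :=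
  Over.OverMorphism.ext (EffectiveEpi.fac
    (P.quotientMapOver L S hS q hSq ⊗ₘ P.quotientMapOver L S hS q hSq).left
    (μ ≫ P.quotientMapOver L S hS q hSq).left
    (fun g₁ g₂ hg ↦ P.mulDesc_cond L S hS q hSq g₁ g₂ hg))

/-- `((a ≫ h) ⊗ (b ≫ h)) ≫ μ_{P/S} = (a ⊗ b) ≫ μ ≫ h`. [folklore] -/
theorem comp_tensorHom_comp_quotMul {X Y : SchemeOver K} (a : X ⟶ P.X) (b : Y ⟶ P.X) :
    ((a ≫ P.quotientMapOver L S hS q hSq) ⊗ₘ (b ≫ P.quotientMapOver L S hS q hSq)) ≫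
        P.quotMul L S hS q hSq = (a ⊗ₘ b) ≫ μ ≫ P.quotientMapOver L S hS q hSq := by
  rw [← tensorHom_comp_tensorHom, Category.assoc, tensorHom_quotMul]

/-- `lift (a ≫ h) (b ≫ h) ≫ μ_{P/S} = (a · b) ≫ h`. [folklore] -/
theorem lift_comp_quotMul {T : SchemeOver K} (a b : T ⟶ P.X) :
    lift (a ≫ P.quotientMapOver L S hS q hSq) (b ≫ P.quotientMapOver L S hS q hSq) ≫
        P.quotMul L S hS q hSq = (a * b) ≫ P.quotientMapOver L S hS q hSq := by
  rw [← lift_map, Category.assoc, tensorHom_quotMul, Hom.mul_def, Category.assoc]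

/-! ### The unit and the inverse of `P/S` -/

/-- **The unit of `P/S`**: the image of the unit of `P`. [folklore] -/
def quotOne : 𝟙_ (SchemeOver K) ⟶ P.quotOver L S hS q hSq := η ≫ P.quotientMapOver L S hS q hSq

/-- The descent datum for the inverse: `ι ≫ h` coequalises the kernel pair of `h`
(`h(a₁⁻¹) = h(a₁⁻¹ a₂⁻¹ · a₂) = h(a₁⁻¹ a₂⁻¹ · a₁) = h(a₂⁻¹)`). [folklore] -/
theorem invDesc_cond {Z : Scheme.{u}} (g₁ g₂ : Z ⟶ P.X.left)
    (hg : g₁ ≫ (P.quotientMapOver L S hS q hSq).left = g₂ ≫ (P.quotientMapOver L S hS q hSq).left) :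
    g₁ ≫ (ι ≫ P.quotientMapOver L S hS q hSq).left =
      g₂ ≫ (ι ≫ P.quotientMapOver L S hS q hSq).left := by
  let ZO : SchemeOver K := Over.mk (g₁ ≫ P.X.hom)
  let G₁ : ZO ⟶ P.X := Over.homMk g₁ rfl
  have hw₂ : g₂ ≫ P.X.hom = g₁ ≫ P.X.hom := by
    rw [← Over.w (P.quotientMapOver L S hS q hSq), ← Category.assoc, ← hg, Category.assoc]
  let G₂ : ZO ⟶ P.X := Over.homMk g₂ hw₂
  have hG : G₁ ≫ P.quotientMapOver L S hS q hSq = G₂ ≫ P.quotientMapOver L S hS q hSq :=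
    Over.OverMorphism.ext hg
  change (G₁ ≫ ι ≫ P.quotientMapOver L S hS q hSq).left =
    (G₂ ≫ ι ≫ P.quotientMapOver L S hS q hSq).left
  congr 1
  rw [← Category.assoc, ← Category.assoc, ← Hom.inv_def, ← Hom.inv_def]
  calc G₁⁻¹ ≫ P.quotientMapOver L S hS q hSq
      = ((G₁⁻¹ * G₂⁻¹) * G₂) ≫ P.quotientMapOver L S hS q hSq := by rw [inv_mul_cancel_right]
    _ = ((G₁⁻¹ * G₂⁻¹) * G₁) ≫ P.quotientMapOver L S hS q hSq :=
        P.mul_comp_quotientMapOver_eq_of_eq L S hS q hSq _ _ _ _ rfl hG.symm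
    _ = G₂⁻¹ ≫ P.quotientMapOver L S hS q hSq := by rw [mul_comm G₁⁻¹, inv_mul_cancel_right]

/-- **The inverse of `P/S`**: the descent of `ι ≫ h` along `h`. [folklore] -/
def quotInv : P.quotOver L S hS q hSq ⟶ P.quotOver L S hS q hSq :=
  Over.homMk (EffectiveEpi.desc (P.quotientMapOver L S hS q hSq).left
    (ι ≫ P.quotientMapOver L S hS q hSq).left
    (fun g₁ g₂ hg ↦ P.invDesc_cond L S hS q hSq g₁ g₂ hg)) (by
      rw [← cancel_epi (P.quotientMapOver L S hS q hSq).left, EffectiveEpi.fac_assoc, Over.w,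
        Over.w])

/-- The defining property of the inverse: `h ≫ ι_{P/S} = ι ≫ h`. [folklore] -/
@[reassoc]
theorem quotientMapOver_quotInv :
    P.quotientMapOver L S hS q hSq ≫ P.quotInv L S hS q hSq = ι ≫ P.quotientMapOver L S hS q hSq :=
  Over.OverMorphism.ext (EffectiveEpi.fac (P.quotientMapOver L S hS q hSq).left
    (ι ≫ P.quotientMapOver L S hS q hSq).left
    (fun g₁ g₂ hg ↦ P.invDesc_cond L S hS q hSq g₁ g₂ hg))

/-! ### `P/S` is a group scheme and `h` is a homomorphism -/

/-- **The group-scheme structure on `P/S`** descended from `P` along `h`: the axioms hold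
after precomposition with the epimorphisms `h`, `h ⊗ h`, `(h ⊗ h) ⊗ h`, where they reduce to
those of `P` (Mumford, *Abelian Varieties*, §7 Thm. 4, §12; Görtz–Wedhorn II, Thm. 27.68).
[cite: MumfordAV1970, §7 Thm. 4 p. 72] -/
instance grpObj_quotOver : GrpObj (P.quotOver L S hS q hSq) where
  one := P.quotOne L S hS q hSq
  mul := P.quotMul L S hS q hSq
  inv := P.quotInv L S hS q hSq
  one_mul := by
    haveI := epi_whiskerLeft (X := 𝟙_ (SchemeOver K)) (P.quotientMapOver L S hS q hSq)
    rw [← cancel_epi (𝟙_ (SchemeOver K) ◁ P.quotientMapOver L S hS q hSq),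
      leftUnitor_naturality, ← id_tensorHom, ← tensorHom_id, tensorHom_comp_tensorHom_assoc,
      Category.id_comp, Category.comp_id, quotOne]
    have := P.comp_tensorHom_comp_quotMul L S hS q hSq η (𝟙 P.X)
    rw [Category.id_comp] at this
    rw [this, tensorHom_id, MonObj.one_mul_assoc]
  mul_one := by
    haveI := epi_whiskerRight (X := 𝟙_ (SchemeOver K)) (P.quotientMapOver L S hS q hSq)
    rw [← cancel_epi (P.quotientMapOver L S hS q hSq ▷ 𝟙_ (SchemeOver K)),
      rightUnitor_naturality, ← id_tensorHom, ← tensorHom_id, tensorHom_comp_tensorHom_assoc,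
      Category.id_comp, Category.comp_id, quotOne]
    have := P.comp_tensorHom_comp_quotMul L S hS q hSq (𝟙 P.X) η
    rw [Category.id_comp] at this
    rw [this, id_tensorHom, MonObj.mul_one_assoc]
  mul_assoc := by
    haveI := epi_tensorHom (P.quotientMapOver L S hS q hSq ⊗ₘ P.quotientMapOver L S hS q hSq)
      (P.quotientMapOver L S hS q hSq)
    rw [← cancel_epi ((P.quotientMapOver L S hS q hSq ⊗ₘ P.quotientMapOver L S hS q hSq) ⊗ₘ
      P.quotientMapOver L S hS q hSq), associator_naturality_assoc, ← tensorHom_id,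
      ← id_tensorHom, tensorHom_comp_tensorHom_assoc, tensorHom_comp_tensorHom_assoc,
      Category.comp_id, tensorHom_quotMul]
    have h₁ := P.comp_tensorHom_comp_quotMul L S hS q hSq μ (𝟙 P.X)
    have h₂ := P.comp_tensorHom_comp_quotMul L S hS q hSq (𝟙 P.X) μ
    rw [Category.id_comp] at h₁ h₂
    rw [h₁, h₂, tensorHom_id, id_tensorHom, MonObj.mul_assoc_assoc]
  left_inv := by
    rw [← cancel_epi (P.quotientMapOver L S hS q hSq), comp_lift_assoc, quotientMapOver_quotInv,
      Category.comp_id, comp_toUnit_assoc]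
    have := P.lift_comp_quotMul L S hS q hSq ι (𝟙 P.X)
    rw [Category.id_comp] at this
    rw [this, GrpObj.inv_eq_inv, inv_mul_cancel, Hom.one_def, Category.assoc]
    rfl
  right_inv := by
    rw [← cancel_epi (P.quotientMapOver L S hS q hSq), comp_lift_assoc, quotientMapOver_quotInv,
      Category.comp_id, comp_toUnit_assoc]
    have := P.lift_comp_quotMul L S hS q hSq (𝟙 P.X) ι
    rw [Category.id_comp] at this
    rw [this, GrpObj.inv_eq_inv, mul_inv_cancel, Hom.one_def, Category.assoc]
    rfl

/-- `h : P → P/S` is a homomorphism of group schemes. [folklore] -/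
instance isMonHom_quotientMapOver : IsMonHom (P.quotientMapOver L S hS q hSq) where
  one_hom := rfl
  mul_hom := (P.tensorHom_quotMul L S hS q hSq).symm

/-! ### The quotient abelian variety and the isogeny `h` -/

/-- **The quotient abelian variety `P/S`** of `P` by the finite Galois-stable subgroup
`S ⊆ P(L)` killed by the isogeny `q` (Mumford, *Abelian Varieties*, §7 Thm. 4 p. 72 and
§12 Thm. 1; Kieffer, Prop. 1.1.10): the `K`-scheme `P/S = (P_L)/(S ⋊ Gal(L/K))` with the
descended group law; it is proper (`P/S → P` finite) and geometrically integral.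
[cite: MumfordAV1970, §7 Thm. 4 p. 72] -/
def quot (hq : IsFinite (Hom.toSchemeHom q)) : AbelianVariety K where
  X := P.quotOver L S hS q hSq
  isProper := P.isProper_quotOver L S hS q hSq hq
  geometricallyIntegral := P.geometricallyIntegral_quotOver L S hS q hSq

/-- **The quotient isogeny `h : P → P/S`** as a morphism of abelian varieties. [folklore] -/
def quotHom (hq : IsFinite (Hom.toSchemeHom q)) : P ⟶ P.quot L S hS q hSq hq :=
  InducedCategory.homMk (Grp.homMk'' (A := P.toGrp) (B := (P.quot L S hS q hSq hq).toGrp)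
    (P.quotientMapOver L S hS q hSq) rfl (P.tensorHom_quotMul L S hS q hSq).symm)

/-- The underlying scheme morphism of `quotHom` is `h = quotientMap`. [folklore] -/
@[simp]
theorem toSchemeHom_quotHom (hq : IsFinite (Hom.toSchemeHom q)) :
    Hom.toSchemeHom (P.quotHom L S hS q hSq hq) = P.quotientMap L S hS q hSq := rfl

/-- The underlying `K`-morphism of `quotHom` is `quotientMapOver`. [folklore] -/
theorem quotHom_hom (hq : IsFinite (Hom.toSchemeHom q)) :
    (P.quotHom L S hS q hSq hq).hom.hom.hom = P.quotientMapOver L S hS q hSq := rfl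

/-- **`h : P → P/S` is an isogeny** (surjective and finite). [folklore] -/
theorem isIsogeny_quotHom (hq : IsFinite (Hom.toSchemeHom q)) :
    IsIsogeny (P.quotHom L S hS q hSq hq) :=
  ⟨P.surjective_quotientMap L S hS q hSq, P.isFinite_quotientMap L S hS q hSq hq⟩

end AbelianVariety

end Literature.AlgebraicGeometry.Motives

namespace Literature.AlgebraicGeometry.Motives

namespace AbelianVariety

open scoped MonObj Obj
open Literature.AlgebraicGeometry.RelativeSpec Literature.AlgebraicGeometry.Morphisms
open MonoidalCategory CartesianMonoidalCategory

variable {K : Type u} [Field K] (L : Type u) [Field L] [Algebra K L] (P : AbelianVariety K)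
variable (S : Subgroup (P.Points L))
  (hS : ∀ (σ : L ≃ₐ[K] L) (s : P.Points L), s ∈ S → σ • s ∈ S)
  (q : P ⟶ P) (hSq : ∀ s ∈ S, s ≫ q.hom.hom.hom = 1)
variable [FiniteDimensional K L] [IsGalois K L] [Finite S] [IsAffineHom (Hom.toSchemeHom q)]

/-! ### `Ker h ⊆ Ker q` -/

/-- The structure map `P/S → P` as a morphism of `K`-schemes. [folklore] -/
def quotToBase : P.quotOver L S hS q hSq ⟶ P.X :=
  Over.homMk (P.quotAction L S hS q hSq).quotientToBase rfl

/-- `h ≫ (P/S → P) = q` over `K`. [folklore] -/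
@[reassoc]
theorem quotientMapOver_quotToBase :
    P.quotientMapOver L S hS q hSq ≫ P.quotToBase L S hS q hSq = q.hom.hom.hom :=
  Over.OverMorphism.ext (P.quotientMap_quotientToBase L S hS q hSq)

/-- **`Ker h ⊆ Ker q` on `T`-points**: if `x ≫ h = 1` then `x ≫ q = x ≫ h ≫ (P/S → P) = 1`
(the map `P/S → P` takes the unit to the unit, being under `P` via `q`). [folklore] -/
theorem comp_eq_one_of_comp_quotientMapOver_eq_one {T : SchemeOver K} (x : T ⟶ P.X)
    (hx : x ≫ P.quotientMapOver L S hS q hSq = 1) : x ≫ q.hom.hom.hom = 1 := by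
  rw [← P.quotientMapOver_quotToBase L S hS q hSq, ← Category.assoc, hx, Hom.one_def, Hom.one_def,
    Category.assoc]
  congr 1
  change (η[P.X] ≫ P.quotientMapOver L S hS q hSq) ≫ P.quotToBase L S hS q hSq = η[P.X]
  rw [Category.assoc, quotientMapOver_quotToBase, IsMonHom.one_hom]

/-! ### The kernel of `h` on field-valued points -/

/-- **The fibre of `h` over the origin on `Ω`-points is `S`.** For a field `Ω` with an
`L`-structure `λ` over `K` and an `Ω`-point `x` of `P`: `h x = 1 ↔ x = s ∘ λ` for some `s ∈ S`
(`⇒`: the orbit lemma `exists_eq_point_mul` with `B₁ = 1`; `⇐`: translation invariance of `h`).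
(Mumford, *Abelian Varieties*, §7 Thm. 4: `Ker (P → P/S) = S`.) [cite: MumfordAV1970, §7 Thm. 4 p. 72] -/
theorem comp_quotientMapOver_eq_one_iff {Ω : Type u} [Field Ω] (κ : Spec (.of Ω) ⟶ Spec (.of K))
    (lam : Spec (.of Ω) ⟶ Spec (.of L)) (hlam : lam ≫ bcSpec K L = κ) (x : Over.mk κ ⟶ P.X) :
    x ≫ P.quotientMapOver L S hS q hSq = 1 ↔
      ∃ s : S, x = (Over.homMk lam hlam : Over.mk κ ⟶ specOver K L) ≫ (s : P.Points L) := by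
  constructor
  · intro hx
    obtain ⟨s, hs⟩ := P.exists_eq_point_mul L S hS q hSq κ lam hlam 1 x
      (by rw [hx, MonObj.one_comp])
    exact ⟨s, by rw [hs, mul_one]⟩
  · rintro ⟨s, rfl⟩
    have hw : (1 : Over.mk κ ⟶ P.X).left ≫ P.X.hom = lam ≫ bcSpec K L := by
      rw [hlam]; exact Over.w (1 : Over.mk κ ⟶ P.X)
    let V : Over.mk κ ⟶ P.bcOverK L :=
      Over.homMk (pullback.lift (1 : Over.mk κ ⟶ P.X).left lam hw) (by
        change pullback.lift _ _ _ ≫ pullback.snd P.X.hom (bcSpec K L) ≫ bcSpec K L = κ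
        rw [pullback.lift_snd_assoc, hlam])
    have h1 : V ≫ P.fstPt L = 1 := by
      ext
      exact pullback.lift_fst _ _ _
    have h2 : V ≫ P.constPt L s =
        (Over.homMk lam hlam : Over.mk κ ⟶ specOver K L) ≫ (s : P.Points L) := by
      ext
      change pullback.lift _ _ _ ≫ pullback.snd P.X.hom (bcSpec K L) ≫ (s : P.Points L).left =
        lam ≫ (s : P.Points L).left
      rw [pullback.lift_snd_assoc]
    have h := P.constPt_mul_fstPt_comp_quotientMapOver L S hS q hSq V s
    rwa [h1, h2, mul_one, MonObj.one_comp] at h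

end AbelianVariety

end Literature.AlgebraicGeometry.Motives
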